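import Summits.AtomisticToContinuum.BoseEinsteinCondensation.Theses.BECThomsonPrinciple
import Literature.MathematicalPhysics.QuantumManyBody.WeightedCorrector
import Literature.MathematicalPhysics.QuantumManyBody.PeriodicBoseGasFourier
import Literature.MathematicalPhysics.QuantumManyBody.PeriodicBoseGasScatteringODE
import HarnessLib.Audit

/-!
# Line `force-balance-constitutive` — crux `DensityResponse` (stmt-AtomisticToContinuum-9481)

Crux-plan skeleton (planner, 2026-08-16) for the crux idea
`Cruxes/DensityResponse/Ideas/force-balance-constitutive.md` (triage r1: pass ×3), route
`BECThomsonPrinciple` (rank 4).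

**Crux.** `DensityResponse`: for every repulsive finite-range `v` (hard cores included) and window `M` there are
`ρ₀, C, N₀` with `E₀^per(v,N,L) + s|m_k(Φ)| ≤ E_v(Φ) + C s² N/(k∞² + ρa)` for all `N ≥ N₀`, `N ≤ ρ₀L³`,
`k = 2πn/L ≠ 0` in the window, `s ≥ 0`, every periodic `C¹` state `Φ`; `m_k(Φ) = ∫(∑ᵢ 2cos k·xᵢ)|Φ|²`.

**Lever.** Inner variation of every trial state along the density-wave displacement field
`u_k(x) = k sin(k·x)/|k|²` (transport of all bosons with the half-density Jacobian): `dE/dτ = -P_k`,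
`dm/dτ = -N_eff`, with the STRESS WAVE `P_k = K_k + (|k|²/4)m + I_k` (`stressWave`). Minimising the driven
functional `E - s·m` over the flow time makes the state TRANSPORT-STATIONARY, `P_k = s·N_eff` (the `k`-component
of the local momentum balance), at no cost and with NO reference to `E₀(v)`; on such states the crux is the
CONSTITUTIVE INEQUALITY `K_k + I_k ≥ κ·ρa·m - C₁ s N` (Bogoliubov: `(K_k+I_k)/m = 4πρa` at every `k`).

**Stubs** (5; statements `Goal.stub_*` = the defs below; hardest = `stub_constitutiveCore`):
* S1 `stub_transportStationary : TransportStationary` — normal form of a finite-energy state under a bounded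
  admissible `w`: half-wavelength translation (sign of `m`) + transport along `u_k` to the minimum of `E - s m`:
  `∃ Φ'` with `E_w(Φ') - s m(Φ') ≤ E_w(Φ) - s|m(Φ)|` and `P_k(Φ') = s N_eff(Φ')` (size M–L).
* S2 `stub_constitutiveCore : ConstitutiveCore` — THE OPEN CORE `C⁺` in the sub-healing drive window
  `s ≤ ρa(v)`: `CoreIneq` for the truncations `v_t = min(v,t)`, `t ≥ t₀`, of any admissible envelope `v`, with
  constants uniform in `t`: transport-stationary ∧ sub-ground ∧ `m ≥ 0` ⟹ `κ ρa(v) m ≤ K_k + I_k + C₁ s N`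
  (XL, open — equivalent there to the crux's linear-response content, `E₀(v)` eliminated from the conclusion).
* S3a `stub_kineticSignCoherenceBounded : KineticSignCoherenceBounded` — super-healing drives `s ≥ ρa(v)`,
  BOUNDED `v`: on finite-energy transport-stationary sub-ground states the stress–virial wave is not anti-phased
  with the drive beyond `O(sN)`, `K_k + I_k ≥ -C′ s N` (the card's item (3b); M–L modulo the integrated virial
  domination; the line's first landable piece).
* S3b `stub_kineticSignCoherenceUnbounded : KineticSignCoherenceUnbounded` — the same for UNBOUNDED `v` (hard
  cores), on the truncations `v_t`, uniformly in `t ≥ t₀` (L–XL: contact form of the virial wave).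
* S4 `stub_truncationLimit : TruncationLimit` — VERBATIM the sibling stub of
  `Cruxes/StaticResponseBound/Lines/uv-thomson-force-wave.lean`: at fixed `(N, L)`,
  `E₀^per(min(v,t)) → E₀^per(v)` (M–L; Rellich + lower semicontinuity + `C¹` density off the core set).
* `body_of_ineqs` (kernel-checked): S1 + S4 + the two regime inequalities for the truncations ⟹ the crux body
  for `(v, M)` — `ε`-argument over the truncation height `t = max(t₀, t₀′, t₁(ε))`; for `v_t` the chord
  `E₀(v_t) - T ≤ E_{v_t}(Φ) - s|m|`, `T = C s² N/(k∞² + ρa(v))`, `C = max(4(2+C₁)/min(1,4κ), 8(2+C′), 4)`, by S1 +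
  `real_chord` (the closing algebra: `m'(q + 4κρa) ≤ 4(2+C₁)sN` resp. `m'q ≤ 4(2+C′)sN`, `q = |k|² ≥ k∞²`, and
  the trivial regime `k∞² < ρa < s` via `|m| ≤ 2N`); then `E_{v_t} ≤ E_v`, S4, `ε → 0`, `ℝ≥0∞` dress.
  `DensityResponse_of : S1 → S2 → S3a → S3b → S4 → BECThomsonPrinciple.DensityResponse` splits on boundedness of
  `v` (bounded: `v_t = v` for `t ≥ ⌈B⌉`, S3a; unbounded: S3b); `DensityResponse_proof` = `_of` applied to the
  five stubs.

**Disproof.lean used** (cdisprove 2026-08-15 22:37Z–23:04Z; theorem names from the item's evidence notes — the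
file itself is not mounted on this hub and nothing of it has landed under `Theorems/DensityResponse/Negative/`):
(a) `¬DensityResponseWithoutModeNeZero` — `n ≠ 0` is a hypothesis of S1–S3b (`stressWave`/`effNumber` degenerate
at `n = 0`: S1 is FALSE there); (h) `densityResponseNoAbs_iff` — the sign of `m` is fixed inside S1 by the
half-wavelength translation (`PeriodicTrialState.exists_translate`), so S2 only sees `m ≥ 0`; (d)
`densityResponseAllSigns_iff` — `s ≥ 0` throughout; (g) `abs_source_le`/`chord_trivial_large_s` — re-proved here
(`abs_sourceMean_le`) and used for the regime `k∞² < ρa < s`; `forall_chord_iff` — the composition goes through the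
linear-response form `m' ≤ C s N/(k∞²+ρa)` on sub-ground states; (f) `holds_free_four`/`free_type_bound_all_v` —
the subtraction of `E₀(v)` is done by STATIONARITY (S1), not by an energy bound; (b)/(c) `two_le_of_holds_free`,
`not_holds_uniform_constant_lt_two` — our `C ≥ 4`. No landed Negative lemma exists for this crux, so no stub can
be an instance of one.
-/

namespace Summit.AtomisticToContinuum.BoseEinsteinCondensation.Cruxes.DensityResponse.ForceBalanceConstitutive

open MeasureTheory
open scoped ENNReal
open Literature.MathematicalPhysics.QuantumManyBody.BoseGas
open Summit.AtomisticToContinuum.BoseEinsteinCondensation.Theses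

noncomputable section

/-! ### Vocabulary of the line (all over existing declarations) -/

section Vocabulary

variable {N : ℕ} {L : ℝ}

/-- The wave vector `k = (2π/L)·n ∈ ℝ³`. -/
def kvec (L : ℝ) (n : Fin 3 → ℤ) : Space := WithLp.toLp 2 fun j => 2 * Real.pi / L * (n j : ℝ)

/-- `q = |k|² = (2π/L)² ∑ⱼ nⱼ²` (Euclidean; the crux's denominator uses the sup norm `k∞² = ksupSq ≤ q ≤ 3 k∞²`). -/
def ksq (L : ℝ) (n : Fin 3 → ℤ) : ℝ := (2 * Real.pi / L) ^ 2 * ∑ j, (n j : ℝ) ^ 2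

/-- The crux's sup-norm wavenumber squared `k∞² = (2π‖n‖∞/L)²`. -/
def ksupSq (L : ℝ) (n : Fin 3 → ℤ) : ℝ := (2 * Real.pi * ‖(fun j => (n j : ℝ))‖ / L) ^ 2

/-- The phase `θᵢ(X) = k·xᵢ`. -/
def phase (L : ℝ) (n : Fin 3 → ℤ) (X : Config N) (i : Fin N) : ℝ :=
  2 * Real.pi / L * ∑ j, (n j : ℝ) * X i j

/-- `k·∇ᵢ g (X)`. -/
def kDeriv (L : ℝ) (n : Fin 3 → ℤ) (g : Config N → ℂ) (X : Config N) (i : Fin N) : ℂ :=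
  fderiv ℝ g X (Pi.single i (kvec L n))

/-- The (signed) DENSITY WAVE `m(Φ) = ∫_{cell^N} (∑ᵢ 2cos θᵢ)|Φ|²` — literally the crux's source integral
(without `|·|`, which is decoration: Disproof (h) `densityResponseNoAbs_iff`). -/
def sourceMean (n : Fin 3 → ℤ) (Φ : PeriodicTrialState N L) : ℝ :=
  ∫ X in cellN N L, (∑ i, 2 * Real.cos (2 * Real.pi / L * ∑ j, (n j : ℝ) * X i j)) * ‖Φ.ψ X‖ ^ 2

/-- `N_eff(Φ) = 2∫(∑ᵢ sin² θᵢ)|Φ|² ∈ [0, 2N]` — minus the first variation of `m` along the flow of `u_k`. -/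
def effNumber (n : Fin 3 → ℤ) (Φ : PeriodicTrialState N L) : ℝ :=
  ∫ X in cellN N L, (∑ i, 2 * Real.sin (phase L n X i) ^ 2) * ‖Φ.ψ X‖ ^ 2

/-- KINETIC STRESS WAVE `K_k(Φ) = 2∫ ∑ᵢ cos θᵢ |k̂·∇ᵢΦ|²` (modulated longitudinal kinetic energy). -/
def kineticStressWave (n : Fin 3 → ℤ) (Φ : PeriodicTrialState N L) : ℝ :=
  ∫ X in cellN N L, ∑ i, 2 * Real.cos (phase L n X i) * (‖kDeriv L n Φ.ψ X i‖ ^ 2 / ksq L n)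

/-- VIRIAL WAVE `I_k(Φ) = ∫ W(X)·∑ᵢ[cos θᵢ|Φ|² + (sin θᵢ/|k|²)·2Re(Φ̄ k·∇ᵢΦ)] dX = ∫ W div_X(|Φ|² U)`,
`W = ∑_{i<j} w^per(xᵢ-xⱼ)`, `U = (u_k(x₁),…,u_k(x_N))`: minus the first variation of the interaction along
the flow of `u_k` (for `w ∈ C¹` it is `-∫|Φ|²∑_{i<j}(u_k(xᵢ)-u_k(xⱼ))·∇w(xᵢ-xⱼ)`, the modulated virial; the
derivative sits on `|Φ|²`, so only measurability of `w` is used). -/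
def virialWave (w : ℝ → ℝ≥0∞) (n : Fin 3 → ℤ) (Φ : PeriodicTrialState N L) : ℝ :=
  ∫ X in cellN N L, (periodicInteraction w L X).toReal *
    ∑ i, (Real.cos (phase L n X i) * ‖Φ.ψ X‖ ^ 2
      + Real.sin (phase L n X i) / ksq L n * (2 * ((starRingEnd ℂ) (Φ.ψ X) * kDeriv L n Φ.ψ X i).re))

/-- STRESS WAVE `P_k(Φ) = K_k + (|k|²/4)·m + I_k` — minus the first variation of `periodicEnergy w` along
the flow of `u_k` (`(|k|²/4)m` is the kinetic energy of the half-density Jacobian factor). -/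
def stressWave (w : ℝ → ℝ≥0∞) (n : Fin 3 → ℤ) (Φ : PeriodicTrialState N L) : ℝ :=
  kineticStressWave n Φ + ksq L n / 4 * sourceMean n Φ + virialWave w n Φ

end Vocabulary

/-! ### The five stubs' statements -/

/-- **S1 — transport-stationarity normal form (size M–L).** For a BOUNDED admissible `w`, `L > 0`, a mode
`n ≠ 0`, a drive `s ≥ 0` and a finite-energy periodic state `Φ` there is a finite-energy state `Φ'` with no
larger driven energy than the better-signed translate of `Φ`, `E_w(Φ') - s·m(Φ') ≤ E_w(Φ) - s·|m(Φ)|`, which is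
TRANSPORT-STATIONARY: `P_k(Φ') = s·N_eff(Φ')`. Proof plan: half-wavelength translation
(`PeriodicTrialState.exists_translate`, `periodicEnergy_translate`) makes `m ≥ 0`, i.e. `m = |m|`; transport
`Φ^τ := (Φ∘F_{-τ})·Jac_τ^{1/2}` along the product flow `F_τ` of `U = (u_k(x₁),…,u_k(x_N))`,
`u_k(x) = k sin(k·x)/|k|²` (closed form `tan(θ/2) ↦ e^{τ}tan(θ/2)` per particle along `k̂`; smooth, `Lℤ³`-periodic,
commutes with permutations) stays in `PeriodicTrialState N L`; `τ ↦ E_w(Φ^τ)` and `τ ↦ m(Φ^τ)` are `C¹` (kinetic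
part in flattened variables `Y = F_{-τ}X`, where only `Φ, ∇Φ` enter; interaction with `τ` inside
`|Φ|²∘F_{-τ}·Jac_τ`, dominated differentiation for bounded `w`), `E_w(Φ^τ) → +∞` as `|τ| → ∞` (the flow squeezes
`|Φ|²` onto the attracting planes; Weizsäcker), so the minimum of `E_w - s·m` over `τ` is attained and its
derivative `-P_k + s·N_eff` vanishes there (`dE/dτ = -P_k`, `dm/dτ = -N_eff`: the commutator identities
`⟨[-Δ,D]⟩ = K_k + (|k|²/4)m`, `⟨[W,D]⟩ ↦ I_k`, `⟨[V_k,D]⟩ = N_eff` for `D = ∑ᵢ(u_k(xᵢ)·∇ᵢ + ½cos θᵢ)`, re-derived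
by triage r1-2 §E5; any positive multiple of `u_k` gives the same identity). FALSE at `n = 0` (Disproof (a)):
`n ≠ 0` is load-bearing here. Trivial for `N = 0` (`Φ' = Φ`, all waves vanish). -/
def TransportStationary : Prop :=
  ∀ (N : ℕ) (L : ℝ) (w : ℝ → ℝ≥0∞), IsRepulsiveFiniteRange w → (∃ B : ℝ, ∀ r, w r ≤ ENNReal.ofReal B) →
    0 < L → ∀ n : Fin 3 → ℤ, n ≠ 0 → ∀ s : ℝ, 0 ≤ s → ∀ Φ : PeriodicTrialState N L,
      periodicEnergy w Φ ≠ ⊤ →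
      ∃ Φ' : PeriodicTrialState N L, periodicEnergy w Φ' ≠ ⊤ ∧
        (periodicEnergy w Φ').toReal - s * sourceMean n Φ' ≤
            (periodicEnergy w Φ).toReal - s * |sourceMean n Φ| ∧
        stressWave w n Φ' = s * effNumber n Φ'

/-- The CONSTITUTIVE INEQUALITY for the potential `w` at scattering-length parameter `a`, window `M`, constants
`ρ₀, κ, C₁, N₀`: for `N ≥ N₀`, `L > 0`, `N ≤ ρ₀L³`, every mode `k = 2πn/L ≠ 0` with `|k| ≤ M√ρ`, every drive
`0 ≤ s ≤ ρ·a` and every finite-energy state `Φ` that is transport-stationary for `w` (`P_k = s N_eff`), sub-ground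
(`E_w(Φ) - s m(Φ) ≤ E₀(w,N,L)`) and positively modulated (`m(Φ) ≥ 0`):
`κ·ρa·m(Φ) ≤ K_k(Φ) + I_k(Φ) + C₁·s·N` (stress–virial wave ≥ half the inverse compressibility × density wave). -/
def CoreIneq (w : ℝ → ℝ≥0∞) (a M ρ₀ κ C₁ : ℝ) (N₀ : ℕ) : Prop :=
  ∀ N : ℕ, N₀ ≤ N → ∀ L : ℝ, 0 < L → (N : ℝ) ≤ ρ₀ * L ^ 3 → ∀ n : Fin 3 → ℤ, n ≠ 0 →
    2 * Real.pi * ‖(fun j => (n j : ℝ))‖ / L ≤ M * Real.sqrt (N / L ^ 3) →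
    ∀ s : ℝ, 0 ≤ s → s ≤ N / L ^ 3 * a →
    ∀ Φ : PeriodicTrialState N L, periodicEnergy w Φ ≠ ⊤ →
      stressWave w n Φ = s * effNumber n Φ →
      (periodicEnergy w Φ).toReal - s * sourceMean n Φ ≤ (periodicGroundStateEnergy w N L).toReal →
      0 ≤ sourceMean n Φ →
        κ * (N / L ^ 3 * a) * sourceMean n Φ ≤ kineticStressWave n Φ + virialWave w n Φ + C₁ * s * N

/-- KINETIC SIGN-COHERENCE for the potential `w` at scattering-length parameter `a`, window `M`, constants
`ρ₀, C', N₀`: as `CoreIneq` but for drives `s ≥ ρ·a` and with no sign condition on `m`: the stress–virial wave of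
a finite-energy transport-stationary sub-ground state is not anti-phased with the drive beyond a multiple of it,
`-C'·s·N ≤ K_k(Φ) + I_k(Φ)` (by stationarity: `m ≤ 4(2+C')sN/|k|²`). -/
def KinIneq (w : ℝ → ℝ≥0∞) (a M ρ₀ C' : ℝ) (N₀ : ℕ) : Prop :=
  ∀ N : ℕ, N₀ ≤ N → ∀ L : ℝ, 0 < L → (N : ℝ) ≤ ρ₀ * L ^ 3 → ∀ n : Fin 3 → ℤ, n ≠ 0 →
    2 * Real.pi * ‖(fun j => (n j : ℝ))‖ / L ≤ M * Real.sqrt (N / L ^ 3) →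
    ∀ s : ℝ, 0 ≤ s → N / L ^ 3 * a ≤ s →
    ∀ Φ : PeriodicTrialState N L, periodicEnergy w Φ ≠ ⊤ →
      stressWave w n Φ = s * effNumber n Φ →
      (periodicEnergy w Φ).toReal - s * sourceMean n Φ ≤ (periodicGroundStateEnergy w N L).toReal →
        -(C' * s * N) ≤ kineticStressWave n Φ + virialWave w n Φ

/-- **S2 — the constitutive core `C⁺` in the sub-healing drive window (THE OPEN CORE; XL).** For every
admissible envelope `v` (hard cores allowed) and window `M` there are `ρ₀, κ, C₁ > 0`, `N₀` and a truncation
height `t₀` such that `CoreIneq` holds, uniformly in `t ≥ t₀`, for the bounded truncation `v_t = min(v, t)`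
(`truncPotential`) with the scattering length `a(v)` of the ENVELOPE (for `t ≥ t₀` large `a(v_t) ≥ a(v)/2`;
`a(v) ≤ R₀ < ∞` for finite range, LSSY App. C Rem. 2). For bounded `v` and `t ≥ sup v` (`v_t = v`) this is
verbatim the card's `ConstitutiveInequality` restricted to `s ≤ ρa`; by the stationarity identity it is
EQUIVALENT there to the crux's linear-response content `m ≤ 4(2+C₁)sN/(|k|² + 4κρa)` (triage r1-1 App. F(i)) —
not weaker, but `E₀(v)` has left the conclusion (it only selects the class), both sides are FIRST order in the
modulation (an additive error `εNρa` costs `δ/ρ ≳ ε`, not `√ε`), and after splitting off the explicit Born piece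
`(ρw(k)/2)·m ≥ 0` what must be bounded below is the pair-sector observable `X_corr` (card item (4)).
Bogoliubov: `K_k + I_k = 4πρa·m` exactly at every `k` (`κ = 4π`, `C₁ = 0`); free gas / `a = 0`: the window is
`s = 0`, the class is `{Ψ₀}` and both sides vanish. Why it might fail: anomalously soft low-`k` density weight of
transport-stationary near-minimisers in the thermodynamic box (the item's why-might-fail, untouched: the card's
LDA accounting reaches `s ≳ ρa(ρa³)^{1/2}` only); for hard-core envelopes the constants must moreover be uniform in
the truncation height. -/
def ConstitutiveCore : Prop :=
  ∀ v : ℝ → ℝ≥0∞, IsRepulsiveFiniteRange v → ∀ M : ℝ, 0 < M →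
    ∃ ρ₀ κ C₁ : ℝ, 0 < ρ₀ ∧ 0 < κ ∧ 0 < C₁ ∧ ∃ N₀ t₀ : ℕ, ∀ t : ℕ, t₀ ≤ t →
      CoreIneq (truncPotential v t) (scatteringLength v).toReal M ρ₀ κ C₁ N₀

/-- **S3a — kinetic sign-coherence at super-healing drives, BOUNDED potentials (M–L; the card's item (3b), the
line's first landable piece).** For a bounded admissible `v` and window `M`: `KinIneq v a(v) M ρ₀ C' N₀` for some
`ρ₀, C' > 0, N₀`. Proof plan: `|K_k| ≤ 2T(Φ) ≤ 2E(Φ)`; the INTEGRATED virial domination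
`|I_k(Φ)| ≤ K_v E(Φ) + K'_v ρa N` on sub-ground states (triage r1-2/3: the pointwise "tame v" class is empty — prove
it as a trace/kinetic trade-off in the pair coordinate, `K_v = K(‖v‖∞, R)`; for a step `V₀𝟙_{r<R}` the virial wave is
`V₀` times a trace of `|Φ|²(uᵢ-uⱼ)·r̂` on the contact spheres); `E(Φ) ≤ E₀ + s·m ≤ E₀ + 2sN` (`|m| ≤ 2N`); Dyson's
upper bound `E₀ ≤ 4πρ₁a(1 + C a/b)N` (PROVED in tree: `LSSY2005_upperBound_periodic_holds`, needs `2R₀ < L`,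
`N ≥ 2`, `a/b ≤ c` — choose `ρ₀`, `N₀`); with `ρa ≤ s`: `C' = (2+K_v)(4π(1+c') + 2) + K'_v`. No smallness of `s`
and no sign of `m` is needed. Why it might fail: only through the virial-domination lemma (a state with finite
energy but a large contact trace) — the constants may depend on `v`, so this is a robustness, not a depth, issue.
Fails in `d = 1` at `k → 2k_F` (Tonks–Lindhard log), correctly outside any dilute window. -/
def KineticSignCoherenceBounded : Prop :=
  ∀ v : ℝ → ℝ≥0∞, IsRepulsiveFiniteRange v → (∃ B : ℝ, ∀ r, v r ≤ ENNReal.ofReal B) → ∀ M : ℝ, 0 < M →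
    ∃ ρ₀ C' : ℝ, 0 < ρ₀ ∧ 0 < C' ∧ ∃ N₀ : ℕ, KinIneq v (scatteringLength v).toReal M ρ₀ C' N₀

/-- **S3b — kinetic sign-coherence at super-healing drives, UNBOUNDED potentials (hard cores; L–XL).** For an
unbounded admissible `v` (hard core, or singular repulsion) and window `M`: `KinIneq (v_t) a(v) M ρ₀ C' N₀`
uniformly in the truncation height `t ≥ t₀`. The bounded-case argument gives `t`-dependent constants
(`K_{v_t} → ∞`); truncation-UNIFORM ones need the contact form of the virial wave: as `t → ∞`,
`I_k(Φ) → V`-independent contact term (`t·|Φ|²` at the core boundary stays `O(1)` for sub-ground states: penetration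
depth `t^{-1/2}`, i.e. the virial theorem for hard spheres), to be dominated by `E(Φ) + ρaN` uniformly in `t` — an
additive `O(sN)` error is affordable here since `s ≥ ρa`. Open but strictly smaller than the crux (large drives
only); the route's other cruxes exclude hard cores outright (FibreConductance), this line isolates them here. -/
def KineticSignCoherenceUnbounded : Prop :=
  ∀ v : ℝ → ℝ≥0∞, IsRepulsiveFiniteRange v → (∀ B : ℝ, ∃ r, ENNReal.ofReal B < v r) → ∀ M : ℝ, 0 < M →
    ∃ ρ₀ C' : ℝ, 0 < ρ₀ ∧ 0 < C' ∧ ∃ N₀ t₀ : ℕ, ∀ t : ℕ, t₀ ≤ t →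
      KinIneq (truncPotential v t) (scatteringLength v).toReal M ρ₀ C' N₀

/-- **S4 — truncation limit at fixed volume (M–L; VERBATIM the sibling stub `TruncationLimit` of
`Cruxes/StaticResponseBound/Lines/uv-thomson-force-wave.lean` — one proof serves both lines).** At FIXED `(N, L)`
the periodic ground-state energies of the truncations `v_t = min(v,t)` converge up to that of `v` whenever the
latter is finite: `∀ ε > 0 ∃ t₁ ∀ t ≥ t₁, E₀^per(v,N,L) ≤ E₀^per(v_t,N,L) + ε` (the other inequality is
monotonicity). Why true: near-minimisers of `v_t` are bounded in `H¹` of the torus, converge (Rellich) to `Ψ ∈ H¹`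
with `∫|∇Ψ|² + ∫v_m|Ψ|² ≤ lim E₀(v_t)` for every `m` (lower semicontinuity), hence `Ψ = 0` a.e. on the core set and
`E_v[Ψ] ≤ lim E₀(v_t)` (monotone convergence); `E₀^per(v) ≤ E_v[Ψ]` by `C¹` approximation in the form norm off the
core set (B. Simon, J. Funct. Anal. 28 (1978) 377; Adams–Hedberg Thm 9.1.3). Trivial for bounded `v`. Used ONLY to
transfer ground-state ENERGIES from `v_t` to `v` (transport moves hard cores, so S1 is run on `v_t`, never on `v`). -/
def TruncationLimit : Prop :=
  ∀ v : ℝ → ℝ≥0∞, IsRepulsiveFiniteRange v → ∀ (N : ℕ) (L : ℝ), 0 < L →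
    periodicGroundStateEnergy v N L ≠ ⊤ →
    ∀ ε : ℝ, 0 < ε → ∃ n₁ : ℕ, ∀ n : ℕ, n₁ ≤ n →
      (periodicGroundStateEnergy v N L).toReal ≤
        (periodicGroundStateEnergy (truncPotential v n) N L).toReal + ε

/-! ### Audit names of the stub statements

`Goal.stub_x` abbreviates the statement of the registered stub `stub_x`, so that the skeleton audit
(`#h21_check_skeleton`, by-name policy on hypothesis heads) reads the hypotheses of `DensityResponse_of` as
exactly the five declared stubs. -/

namespace Goal

/-- Statement of stub S1 `stub_transportStationary`. -/
abbrev stub_transportStationary : Prop := TransportStationary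

/-- Statement of stub S2 `stub_constitutiveCore`. -/
abbrev stub_constitutiveCore : Prop := ConstitutiveCore

/-- Statement of stub S3a `stub_kineticSignCoherenceBounded`. -/
abbrev stub_kineticSignCoherenceBounded : Prop := KineticSignCoherenceBounded

/-- Statement of stub S3b `stub_kineticSignCoherenceUnbounded`. -/
abbrev stub_kineticSignCoherenceUnbounded : Prop := KineticSignCoherenceUnbounded

/-- Statement of stub S4 `stub_truncationLimit`. -/
abbrev stub_truncationLimit : Prop := TruncationLimit

end Goal

/-! ### Registered stubs -/

/-- S1 (M–L): transport-stationarity normal form. -/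
theorem stub_transportStationary : TransportStationary := by
  sorry

/-- S2 (XL, hardest, the open core): the constitutive inequality at drives `s ≤ ρa`. -/
theorem stub_constitutiveCore : ConstitutiveCore := by
  sorry

/-- S3a (M–L, first landable piece): kinetic sign-coherence at drives `s ≥ ρa`, bounded potentials. -/
theorem stub_kineticSignCoherenceBounded : KineticSignCoherenceBounded := by
  sorry

/-- S3b (L–XL): kinetic sign-coherence at drives `s ≥ ρa`, unbounded potentials (hard cores), uniformly in the
truncation height. -/
theorem stub_kineticSignCoherenceUnbounded : KineticSignCoherenceUnbounded := by
  sorry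

/-- S4 (M–L, shared with the sibling line): truncation limit at fixed volume. -/
theorem stub_truncationLimit : TruncationLimit := by
  sorry

/-! ### Elementary lemmas for the composition (sorry-free) -/

section Lemmas

variable {N : ℕ} {L : ℝ}

/-- The truncation `v_t = min(v, t)` of an admissible potential is admissible (same range). [folklore] -/
theorem isRepulsiveFiniteRange_truncPotential {v : ℝ → ℝ≥0∞} (hv : IsRepulsiveFiniteRange v) (t : ℕ) :
    IsRepulsiveFiniteRange (truncPotential v t) := by
  refine ⟨measurable_truncPotential hv.1 t, ?_⟩
  obtain ⟨R₀, hR₀⟩ := hv.2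
  exact ⟨R₀, fun r hr => truncPotential_eq_zero (hR₀ r hr) t⟩

/-- The truncation is bounded by its height. [folklore] -/
theorem truncPotential_le_ofReal_nat (v : ℝ → ℝ≥0∞) (t : ℕ) (r : ℝ) :
    truncPotential v t r ≤ ENNReal.ofReal t := by
  rw [ENNReal.ofReal_natCast]; exact truncPotential_le_nat v t r

/-- A bounded potential is its own truncation beyond its height. [folklore] -/
theorem truncPotential_eq_self_of_le {v : ℝ → ℝ≥0∞} {B : ℝ} (hB : ∀ r, v r ≤ ENNReal.ofReal B) {t : ℕ}
    (ht : B ≤ t) : truncPotential v t = v := by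
  funext r
  unfold truncPotential
  refine min_eq_left ((hB r).trans ?_)
  rw [← ENNReal.ofReal_natCast]
  exact ENNReal.ofReal_le_ofReal ht

/-- Monotonicity of the periodic energy under truncation of the potential. [folklore] -/
theorem periodicEnergy_truncPotential_le (v : ℝ → ℝ≥0∞) (t : ℕ) (Ψ : PeriodicTrialState N L) :
    periodicEnergy (truncPotential v t) Ψ ≤ periodicEnergy v Ψ := by
  unfold periodicEnergy
  refine lintegral_mono fun X => ?_
  refine add_le_add le_rfl (mul_le_mul_left ?_ _)
  unfold periodicInteraction
  refine Finset.sum_le_sum fun i _ => Finset.sum_le_sum fun j _ => ?_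
  unfold periodizedPotential
  exact ENNReal.tsum_le_tsum fun m => truncPotential_le v t _

/-- The Bochner normalisation of an admissible state: `∫_{cell^N} |Ψ|² = 1`. [folklore] -/
theorem integral_norm_sq_eq_one (Ψ : PeriodicTrialState N L) :
    ∫ X in cellN N L, ‖Ψ.ψ X‖ ^ 2 = 1 := by
  have hint : Integrable (fun X => ‖Ψ.ψ X‖ ^ 2) (volume.restrict (cellN N L)) :=
    integrableOn_cellN ((Ψ.contDiff.continuous.norm).pow 2) L
  have h := ofReal_integral_eq_lintegral_ofReal hint
    (Filter.Eventually.of_forall fun X => sq_nonneg _)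
  simp_rw [← coe_nnnorm_sq_eq_ofReal] at h
  rw [Ψ.norm_eq] at h
  have hnn : 0 ≤ ∫ X in cellN N L, ‖Ψ.ψ X‖ ^ 2 := integral_nonneg fun X => sq_nonneg _
  have := congrArg ENNReal.toReal h
  rwa [ENNReal.toReal_ofReal hnn, ENNReal.toReal_one] at this

/-- A bounded continuous weight integrated against `|Ψ|² dX` on the cell is bounded by its bound. [folklore] -/
theorem abs_integral_mul_norm_sq_le (Ψ : PeriodicTrialState N L) {g : Config N → ℝ} (hg : Continuous g)
    {G : ℝ} (hG : ∀ X, |g X| ≤ G) : |∫ X in cellN N L, g X * ‖Ψ.ψ X‖ ^ 2| ≤ G := by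
  have hψc : Continuous fun X => ‖Ψ.ψ X‖ ^ 2 := (Ψ.contDiff.continuous.norm).pow 2
  have hi : IntegrableOn (fun X => g X * ‖Ψ.ψ X‖ ^ 2) (cellN N L) volume :=
    integrableOn_cellN (hg.mul hψc) L
  have hi2 : IntegrableOn (fun X => G * ‖Ψ.ψ X‖ ^ 2) (cellN N L) volume :=
    integrableOn_cellN (continuous_const.mul hψc) L
  calc |∫ X in cellN N L, g X * ‖Ψ.ψ X‖ ^ 2|
      ≤ ∫ X in cellN N L, |g X * ‖Ψ.ψ X‖ ^ 2| := abs_integral_le_integral_abs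
    _ ≤ ∫ X in cellN N L, G * ‖Ψ.ψ X‖ ^ 2 := by
        refine integral_mono hi.abs hi2 fun X => ?_
        show |g X * ‖Ψ.ψ X‖ ^ 2| ≤ G * ‖Ψ.ψ X‖ ^ 2
        rw [abs_mul, abs_of_nonneg (sq_nonneg ‖Ψ.ψ X‖)]
        exact mul_le_mul_of_nonneg_right (hG X) (sq_nonneg _)
    _ = G := by rw [integral_const_mul, integral_norm_sq_eq_one, mul_one]

/-- The phase of particle `i` is continuous in the configuration. [folklore] -/
theorem continuous_phase (L : ℝ) (n : Fin 3 → ℤ) (i : Fin N) :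
    Continuous fun X : Config N => phase L n X i := by
  unfold phase
  refine continuous_const.mul (continuous_finsetSum _ fun j _ => continuous_const.mul ?_)
  fun_prop

/-- `|m(Φ)| ≤ 2N` (Disproof (g) `abs_source_le`, re-proved). [folklore] -/
theorem abs_sourceMean_le (n : Fin 3 → ℤ) (Φ : PeriodicTrialState N L) : |sourceMean n Φ| ≤ 2 * N := by
  unfold sourceMean
  refine abs_integral_mul_norm_sq_le Φ ?_ fun X => ?_
  · refine continuous_finsetSum _ fun i _ => continuous_const.mul (Real.continuous_cos.comp ?_)
    exact continuous_phase L n i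
  · calc |∑ i : Fin N, 2 * Real.cos (2 * Real.pi / L * ∑ j, (n j : ℝ) * X i j)|
        ≤ ∑ i : Fin N, |2 * Real.cos (2 * Real.pi / L * ∑ j, (n j : ℝ) * X i j)| :=
          Finset.abs_sum_le_sum_abs _ _
      _ ≤ ∑ _i : Fin N, (2 : ℝ) := Finset.sum_le_sum fun i _ => by
          rw [abs_mul, abs_of_pos (by norm_num : (0 : ℝ) < 2)]
          nlinarith [Real.abs_cos_le_one (2 * Real.pi / L * ∑ j, (n j : ℝ) * X i j)]
      _ = 2 * N := by
          rw [Finset.sum_const, Finset.card_univ, Fintype.card_fin, nsmul_eq_mul, mul_comm]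

/-- `N_eff(Φ) ≤ 2N`. [folklore] -/
theorem effNumber_le (n : Fin 3 → ℤ) (Φ : PeriodicTrialState N L) : effNumber n Φ ≤ 2 * N := by
  unfold effNumber
  refine (le_abs_self _).trans (abs_integral_mul_norm_sq_le Φ ?_ fun X => ?_)
  · exact continuous_finsetSum _ fun i _ =>
      continuous_const.mul ((Real.continuous_sin.comp (continuous_phase L n i)).pow 2)
  · rw [abs_of_nonneg (Finset.sum_nonneg fun i _ => by positivity)]
    calc ∑ i : Fin N, 2 * Real.sin (phase L n X i) ^ 2
        ≤ ∑ _i : Fin N, (2 : ℝ) := Finset.sum_le_sum fun i _ => by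
          nlinarith [Real.sin_sq_le_one (phase L n X i)]
      _ = 2 * N := by
          rw [Finset.sum_const, Finset.card_univ, Fintype.card_fin, nsmul_eq_mul, mul_comm]

/-- `k∞² ≤ |k|²` (sup norm versus Euclidean norm of the mode). [folklore] -/
theorem ksupSq_le_ksq (L : ℝ) (n : Fin 3 → ℤ) : ksupSq L n ≤ ksq L n := by
  unfold ksupSq ksq
  have hsum : 0 ≤ ∑ j, (n j : ℝ) ^ 2 := Finset.sum_nonneg fun j _ => sq_nonneg _
  have hnorm : ‖(fun j => (n j : ℝ))‖ ≤ Real.sqrt (∑ j, (n j : ℝ) ^ 2) := by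
    refine (pi_norm_le_iff_of_nonneg (Real.sqrt_nonneg _)).2 fun i => ?_
    rw [Real.norm_eq_abs]
    exact Real.abs_le_sqrt
      (Finset.single_le_sum (f := fun j => (n j : ℝ) ^ 2) (fun j _ => sq_nonneg _) (Finset.mem_univ i))
  have h0 : 0 ≤ ‖(fun j => (n j : ℝ))‖ := norm_nonneg _
  have hsq : ‖(fun j => (n j : ℝ))‖ ^ 2 ≤ ∑ j, (n j : ℝ) ^ 2 := by
    calc ‖(fun j => (n j : ℝ))‖ ^ 2 ≤ Real.sqrt (∑ j, (n j : ℝ) ^ 2) ^ 2 := pow_le_pow_left₀ h0 hnorm 2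
      _ = ∑ j, (n j : ℝ) ^ 2 := Real.sq_sqrt hsum
  have : (2 * Real.pi * ‖(fun j => (n j : ℝ))‖ / L) ^ 2 =
      (2 * Real.pi / L) ^ 2 * ‖(fun j => (n j : ℝ))‖ ^ 2 := by ring
  rw [this]
  exact mul_le_mul_of_nonneg_left hsq (sq_nonneg _)

end Lemmas

/-! ### The kernel-checked composition -/

/-- **The closing algebra (pure real arithmetic).** From the normal form (`hdrive`, `hstat`), `N_eff ≤ 2N`,
`|m| ≤ 2N`, and the two regime inequalities — the constitutive core for `s ≤ ρa` and kinetic sign-coherence for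
`s ≥ ρa`, each only on sub-ground positively-modulated states — the chord `E₀ - C s² N/(k∞² + ρa) ≤ E(Φ) - s|m|`
with `C ≥ max(4(2+C₁)/θ, 8(2+C′), 4)`, `θ = min(1, 4κ)`. Cases: `m' < 0` or not sub-ground (trivial); `s ≤ ρa`
(core: `m'(q + 4κρa) ≤ 4(2+C₁)sN`, `θ(k∞² + ρa) ≤ q + 4κρa`); `ρa < s`, `ρa ≤ k∞²` (kinetic: `m'q ≤ 4(2+C′)sN`,
`k∞² + ρa ≤ 2q`); `k∞² < ρa < s` (trivial: `s|m| ≤ 2sN ≤ 4s²N/(k∞²+ρa)`). -/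
theorem real_chord {E₀w E' EwΦ m m' s K I q Nf qs ρa κ C₁ C' θ C Nr : ℝ}
    (hs : 0 ≤ s) (hNr : 0 ≤ Nr) (hqs0 : 0 < qs) (hρa0 : 0 ≤ ρa) (hq : qs ≤ q)
    (hθpos : 0 < θ) (hθ1 : θ ≤ 1) (hθκ : θ ≤ 4 * κ)
    (hC4 : 4 ≤ C) (hCcore : 4 * (2 + C₁) / θ ≤ C) (hCkin : 8 * (2 + C') ≤ C)
    (habs : |m| ≤ 2 * Nr) (hNf : Nf ≤ 2 * Nr)
    (hE₀E' : E₀w ≤ E') (hE₀Ew : E₀w ≤ EwΦ)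
    (hdrive : E' - s * m' ≤ EwΦ - s * |m|)
    (hstat : K + q / 4 * m' + I = s * Nf)
    (hcore : s ≤ ρa → E' - s * m' ≤ E₀w → 0 ≤ m' → κ * ρa * m' ≤ K + I + C₁ * s * Nr)
    (hkin : ρa ≤ s → E' - s * m' ≤ E₀w → -(C' * s * Nr) ≤ K + I) :
    E₀w - C * s ^ 2 * Nr / (qs + ρa) ≤ EwΦ - s * |m| := by
  have hden : 0 < qs + ρa := by positivity
  have hC0 : 0 ≤ C := by linarith
  have hT0 : 0 ≤ C * s ^ 2 * Nr / (qs + ρa) := by positivity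
  have hsNf : s * Nf ≤ s * (2 * Nr) := mul_le_mul_of_nonneg_left hNf hs
  -- the chord from a linear-response bound `m' (k∞² + ρa) ≤ C s N`
  have chord_of_lr : 0 ≤ m' → m' * (qs + ρa) ≤ C * s * Nr →
      E₀w - C * s ^ 2 * Nr / (qs + ρa) ≤ EwΦ - s * |m| := by
    intro hnn h4
    have h5 : s * m' ≤ C * s ^ 2 * Nr / (qs + ρa) := by
      rw [le_div_iff₀ hden]
      nlinarith [mul_le_mul_of_nonneg_left h4 hs]
    linarith
  -- negatively modulated normal form: trivial
  rcases lt_or_ge m' 0 with hneg | hnn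
  · have : s * m' ≤ 0 := by nlinarith
    linarith
  -- normal form not sub-ground: trivial
  rcases lt_or_ge E₀w (E' - s * m') with hsup | hsub
  · linarith
  rcases le_or_gt s ρa with hsmall | hlarge
  · -- sub-healing drive: the constitutive core
    have hci := hcore hsmall hsub hnn
    have h1 : m' * (q + 4 * (κ * ρa)) ≤ 4 * (2 + C₁) * s * Nr := by nlinarith
    have hθden : θ * (qs + ρa) ≤ q + 4 * (κ * ρa) := by
      have e1 : θ * qs ≤ q := (mul_le_of_le_one_left hqs0.le hθ1).trans hq
      have e2 : θ * ρa ≤ 4 * κ * ρa := mul_le_mul_of_nonneg_right hθκ hρa0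
      nlinarith
    have h3 : m' * (qs + ρa) * θ ≤ 4 * (2 + C₁) * (s * Nr) := by
      calc m' * (qs + ρa) * θ = m' * (θ * (qs + ρa)) := by ring
        _ ≤ m' * (q + 4 * (κ * ρa)) := mul_le_mul_of_nonneg_left hθden hnn
        _ ≤ 4 * (2 + C₁) * s * Nr := h1
        _ = 4 * (2 + C₁) * (s * Nr) := by ring
    have h4 : m' * (qs + ρa) ≤ C * s * Nr := by
      have h3' : m' * (qs + ρa) ≤ 4 * (2 + C₁) / θ * (s * Nr) := by
        rw [div_mul_eq_mul_div, le_div_iff₀ hθpos]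
        exact h3
      calc m' * (qs + ρa) ≤ 4 * (2 + C₁) / θ * (s * Nr) := h3'
        _ ≤ C * (s * Nr) := mul_le_mul_of_nonneg_right hCcore (mul_nonneg hs hNr)
        _ = C * s * Nr := by ring
    exact chord_of_lr hnn h4
  · rcases le_or_gt ρa qs with hUV | hIR
    · -- super-healing drive on the UV half: kinetic sign-coherence
      have hk := hkin hlarge.le hsub
      have h1 : m' * q ≤ 4 * (2 + C') * s * Nr := by nlinarith
      have h4 : m' * (qs + ρa) ≤ C * s * Nr := by
        have hd2 : qs + ρa ≤ 2 * q := by linarith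
        calc m' * (qs + ρa) ≤ m' * (2 * q) := mul_le_mul_of_nonneg_left hd2 hnn
          _ = 2 * (m' * q) := by ring
          _ ≤ 2 * (4 * (2 + C') * s * Nr) := by linarith
          _ = 8 * (2 + C') * (s * Nr) := by ring
          _ ≤ C * (s * Nr) := mul_le_mul_of_nonneg_right hCkin (mul_nonneg hs hNr)
          _ = C * s * Nr := by ring
      exact chord_of_lr hnn h4
    · -- `k∞² < ρa < s`: the chord is trivial (`|m| ≤ 2N`)
      have hd2 : qs + ρa ≤ 2 * s := by linarith
      have h5 : s * |m| ≤ C * s ^ 2 * Nr / (qs + ρa) := by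
        rw [le_div_iff₀ hden]
        have e1 : s * |m| * (qs + ρa) ≤ s * (2 * Nr) * (2 * s) :=
          mul_le_mul (mul_le_mul_of_nonneg_left habs hs) hd2 hden.le (by positivity)
        have e2 : 4 * (s ^ 2 * Nr) ≤ C * (s ^ 2 * Nr) := mul_le_mul_of_nonneg_right hC4 (by positivity)
        nlinarith [e1, e2]
      linarith

/-- **The composition, inner form**: S1, S4 and the two regime inequalities — `CoreIneq` and `KinIneq` for the
truncations `v_t`, `t ≥ t₀`, with the envelope's scattering length — give the crux's body for `(v, M)`:
`C := max(4(2+C₁)/min(1,4κ), 8(2+C′), 4)`, `ρ₀ := min`, `N₀ := max`. For data `(N, L, n, s, Φ)` with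
`E_v(Φ) < ∞` the real chord `E₀(v) - T ≤ E_v(Φ) - s|m|`, `T = Cs²N/(k∞²+ρa)`, is proved up to every `ε > 0`
through the truncation `v_t`, `t = max(t₀, t₀′, t₁(ε))`: S1 gives a transport-stationary `Φ'` for `v_t`,
`real_chord` (fed by the two inequalities at `Φ'`) gives the chord for `v_t`, then `E_{v_t} ≤ E_v`, S4 and the
`ℝ≥0∞` dress finish. -/
theorem body_of_ineqs (h₁ : TransportStationary) (h₄ : TruncationLimit) {v : ℝ → ℝ≥0∞}
    (hv : IsRepulsiveFiniteRange v) {M ρ₂ κ C₁ ρ₃ C' : ℝ} (hρ₂ : 0 < ρ₂) (hκ : 0 < κ) (hρ₃ : 0 < ρ₃)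
    {N₂ t₂ N₃ t₃ : ℕ}
    (hcore : ∀ t : ℕ, t₂ ≤ t → CoreIneq (truncPotential v t) (scatteringLength v).toReal M ρ₂ κ C₁ N₂)
    (hkin : ∀ t : ℕ, t₃ ≤ t → KinIneq (truncPotential v t) (scatteringLength v).toReal M ρ₃ C' N₃) :
    ∃ ρ₀ C : ℝ, 0 < ρ₀ ∧ 0 < C ∧ ∃ N₀ : ℕ, ∀ N : ℕ, N₀ ≤ N → ∀ L : ℝ, 0 < L → (N : ℝ) ≤ ρ₀ * L ^ 3 →
      ∀ n : Fin 3 → ℤ, n ≠ 0 → 2 * Real.pi * ‖(fun j => (n j : ℝ))‖ / L ≤ M * Real.sqrt (N / L ^ 3) →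
      ∀ s : ℝ, 0 ≤ s → ∀ Φ : PeriodicTrialState N L,
        periodicGroundStateEnergy v N L + ENNReal.ofReal (s * |∫ X in cellN N L,
            (∑ i, 2 * Real.cos (2 * Real.pi / L * ∑ j, (n j : ℝ) * X i j)) * ‖Φ.ψ X‖ ^ 2|)
          ≤ periodicEnergy v Φ + ENNReal.ofReal (C * s ^ 2 * N /
              ((2 * Real.pi * ‖(fun j => (n j : ℝ))‖ / L) ^ 2 + N / L ^ 3 * (scatteringLength v).toReal)) := by
  -- constants
  have hθpos : 0 < min 1 (4 * κ) := lt_min one_pos (by linarith)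
  have hθ1 : min 1 (4 * κ) ≤ 1 := min_le_left _ _
  have hθκ : min 1 (4 * κ) ≤ 4 * κ := min_le_right _ _
  have hC4 : (4 : ℝ) ≤ max (max (4 * (2 + C₁) / min 1 (4 * κ)) (8 * (2 + C'))) 4 := le_max_right _ _
  have hCcoreC : 4 * (2 + C₁) / min 1 (4 * κ) ≤ max (max (4 * (2 + C₁) / min 1 (4 * κ)) (8 * (2 + C'))) 4 :=
    (le_max_left _ _).trans (le_max_left _ _)
  have hCkinC : 8 * (2 + C') ≤ max (max (4 * (2 + C₁) / min 1 (4 * κ)) (8 * (2 + C'))) 4 :=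
    (le_max_right _ _).trans (le_max_left _ _)
  refine ⟨min ρ₂ ρ₃, max (max (4 * (2 + C₁) / min 1 (4 * κ)) (8 * (2 + C'))) 4, lt_min hρ₂ hρ₃,
    lt_of_lt_of_le (by norm_num) hC4, max N₂ N₃, ?_⟩
  generalize max (max (4 * (2 + C₁) / min 1 (4 * κ)) (8 * (2 + C'))) 4 = C at hC4 hCcoreC hCkinC
  intro N hN L hL hNL n hn hwin s hs Φ
  change periodicGroundStateEnergy v N L + ENNReal.ofReal (s * |sourceMean n Φ|) ≤
    periodicEnergy v Φ + ENNReal.ofReal (C * s ^ 2 * N /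
      ((2 * Real.pi * ‖(fun j => (n j : ℝ))‖ / L) ^ 2 + N / L ^ 3 * (scatteringLength v).toReal))
  have hN₂ : N₂ ≤ N := (le_max_left _ _).trans hN
  have hN₃ : N₃ ≤ N := (le_max_right _ _).trans hN
  have hL3 : (0 : ℝ) ≤ L ^ 3 := by positivity
  have hNL₂ : (N : ℝ) ≤ ρ₂ * L ^ 3 := hNL.trans (mul_le_mul_of_nonneg_right (min_le_left _ _) hL3)
  have hNL₃ : (N : ℝ) ≤ ρ₃ * L ^ 3 := hNL.trans (mul_le_mul_of_nonneg_right (min_le_right _ _) hL3)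
  -- signs
  have hNnn : (0 : ℝ) ≤ N := Nat.cast_nonneg N
  have hρa0 : 0 ≤ (N : ℝ) / L ^ 3 * (scatteringLength v).toReal := by positivity
  have hnR : (fun j => (n j : ℝ)) ≠ 0 := by
    intro h0
    apply hn
    funext j
    have h1 : (n j : ℝ) = 0 := by simpa using congrFun h0 j
    show n j = 0
    exact_mod_cast h1
  have hqs0 : 0 < (2 * Real.pi * ‖(fun j => (n j : ℝ))‖ / L) ^ 2 := by
    have := norm_pos_iff.mpr hnR
    positivity
  have hT0 : 0 ≤ C * s ^ 2 * N /
      ((2 * Real.pi * ‖(fun j => (n j : ℝ))‖ / L) ^ 2 + N / L ^ 3 * (scatteringLength v).toReal) := by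
    have : (0 : ℝ) ≤ C := by linarith
    positivity
  have habs : |sourceMean n Φ| ≤ 2 * N := abs_sourceMean_le n Φ
  have hq : (2 * Real.pi * ‖(fun j => (n j : ℝ))‖ / L) ^ 2 ≤ ksq L n := ksupSq_le_ksq L n
  -- infinite energy: nothing to prove
  by_cases hE : periodicEnergy v Φ = ⊤
  · rw [hE, top_add]; exact le_top
  have hE₀ : periodicGroundStateEnergy v N L ≠ ⊤ :=
    ne_top_of_le_ne_top hE (periodicGroundStateEnergy_le v Φ)
  -- the real chord suffices
  suffices hreal : (periodicGroundStateEnergy v N L).toReal - C * s ^ 2 * N /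
      ((2 * Real.pi * ‖(fun j => (n j : ℝ))‖ / L) ^ 2 + N / L ^ 3 * (scatteringLength v).toReal) ≤
      (periodicEnergy v Φ).toReal - s * |sourceMean n Φ| by
    rw [(ENNReal.ofReal_toReal hE₀).symm, (ENNReal.ofReal_toReal hE).symm,
      ← ENNReal.ofReal_add ENNReal.toReal_nonneg (by positivity),
      ← ENNReal.ofReal_add ENNReal.toReal_nonneg hT0]
    exact ENNReal.ofReal_le_ofReal (by linarith)
  -- … and it is proved up to every `ε > 0` through a tall truncation of `v`
  refine le_of_forall_pos_le_add fun ε hε => ?_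
  obtain ⟨t₁, ht₁⟩ := h₄ v hv N L hL hE₀ ε hε
  obtain ⟨t, ht₂, ht₃, htt₁⟩ : ∃ t : ℕ, t₂ ≤ t ∧ t₃ ≤ t ∧ t₁ ≤ t :=
    ⟨max (max t₂ t₃) t₁, (le_max_left _ _).trans (le_max_left _ _),
      (le_max_right _ _).trans (le_max_left _ _), le_max_right _ _⟩
  have hw : IsRepulsiveFiniteRange (truncPotential v t) := isRepulsiveFiniteRange_truncPotential hv t
  have hwb : ∃ B : ℝ, ∀ r, truncPotential v t r ≤ ENNReal.ofReal B := ⟨t, truncPotential_le_ofReal_nat v t⟩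
  have hEwΦ_le : periodicEnergy (truncPotential v t) Φ ≤ periodicEnergy v Φ :=
    periodicEnergy_truncPotential_le v t Φ
  have hEwΦ : periodicEnergy (truncPotential v t) Φ ≠ ⊤ := ne_top_of_le_ne_top hE hEwΦ_le
  have hEwΦr : (periodicEnergy (truncPotential v t) Φ).toReal ≤ (periodicEnergy v Φ).toReal :=
    ENNReal.toReal_mono hE hEwΦ_le
  have hE₀wr : (periodicGroundStateEnergy (truncPotential v t) N L).toReal ≤
      (periodicEnergy (truncPotential v t) Φ).toReal :=
    ENNReal.toReal_mono hEwΦ (periodicGroundStateEnergy_le _ Φ)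
  have hlim : (periodicGroundStateEnergy v N L).toReal ≤
      (periodicGroundStateEnergy (truncPotential v t) N L).toReal + ε := ht₁ t htt₁
  -- S1: the transport-stationary normal form for the truncated potential
  obtain ⟨Φ', hE', hdrive, hstat⟩ := h₁ N L (truncPotential v t) hw hwb hL n hn s hs Φ hEwΦ
  have hE₀E' : (periodicGroundStateEnergy (truncPotential v t) N L).toReal ≤
      (periodicEnergy (truncPotential v t) Φ').toReal :=
    ENNReal.toReal_mono hE' (periodicGroundStateEnergy_le _ Φ')
  have hstat' : kineticStressWave n Φ' + ksq L n / 4 * sourceMean n Φ' + virialWave (truncPotential v t) n Φ' =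
      s * effNumber n Φ' := hstat
  -- the chord for the truncated potential (closing algebra fed by the two regime inequalities at `Φ'`)
  have key := real_chord hs hNnn hqs0 hρa0 hq hθpos hθ1 hθκ hC4 hCcoreC hCkinC habs (effNumber_le n Φ')
    hE₀E' hE₀wr hdrive hstat'
    (fun hsmall hsub hnn => hcore t ht₂ N hN₂ L hL hNL₂ n hn hwin s hs hsmall Φ' hE' hstat hsub hnn)
    (fun hlarge hsub => hkin t ht₃ N hN₃ L hL hNL₃ n hn hwin s hs hlarge Φ' hE' hstat hsub)
  linarith

/-- **The composition**: the five stubs imply the crux BY NAME — `body_of_ineqs` with the regime inequalities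
taken from S2 and, according as `v` is bounded or not, from S3a (no truncation needed: `v_t = v` for
`t ≥ ⌈B⌉`) or S3b. -/
theorem DensityResponse_of :
    Goal.stub_transportStationary → Goal.stub_constitutiveCore → Goal.stub_kineticSignCoherenceBounded →
      Goal.stub_kineticSignCoherenceUnbounded → Goal.stub_truncationLimit →
        BECThomsonPrinciple.DensityResponse := by
  intro h₁ h₂ h₃ h₃' h₄ v hv M hM
  obtain ⟨ρ₂, κ, C₁, hρ₂, hκ, -, N₂, t₂, hcore⟩ := h₂ v hv M hM
  by_cases hb : ∃ B : ℝ, ∀ r, v r ≤ ENNReal.ofReal B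
  · obtain ⟨ρ₃, C', hρ₃, -, N₃, hkin⟩ := h₃ v hv hb M hM
    obtain ⟨B, hB⟩ := hb
    refine body_of_ineqs h₁ h₄ hv hρ₂ hκ hρ₃ hcore (C' := C') (N₃ := N₃) (t₃ := ⌈B⌉₊) fun t ht => ?_
    rw [truncPotential_eq_self_of_le hB (Nat.ceil_le.mp ht)]
    exact hkin
  · have hub : ∀ B : ℝ, ∃ r, ENNReal.ofReal B < v r := by
      intro B
      by_contra h
      push Not at h
      exact hb ⟨B, h⟩
    obtain ⟨ρ₃, C', hρ₃, -, N₃, t₃, hkin⟩ := h₃' v hv hub M hM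
    exact body_of_ineqs h₁ h₄ hv hρ₂ hκ hρ₃ hcore hkin

/-- The skeleton as a (sorried-through-the-stubs) proof of the crux: `_of` applied to the five stubs. -/
theorem DensityResponse_proof : BECThomsonPrinciple.DensityResponse :=
  DensityResponse_of stub_transportStationary stub_constitutiveCore stub_kineticSignCoherenceBounded
    stub_kineticSignCoherenceUnbounded stub_truncationLimit

end

end Summit.AtomisticToContinuum.BoseEinsteinCondensation.Cruxes.DensityResponse.ForceBalanceConstitutive
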